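/-
COR-CM (cell pub-hodgecm2, stage 2 of the Hodge ladder) — count-neutral KERNEL COMBINATORICS «the sheared dihedral family», part II: the floor
(seat prover-pub-hodgecm2-b23-g52-0, binder prover b23, gen 52; claim «SYLOW TRANSFER XII + THE SHEARED DIHEDRAL FAMILY», HOME/INBOX.md l.23708).
Theorems only, on part I (`Census/ShearedDihedralDatum.lean`), lit-andre-3ʼs type-stabiliser theory (`TypeStabiliser.stabGen`, `indexTwoRank`,
`fibreTwo_add_two_eq_card_block_add_indexTwoRank`) and seat b09ʼs coinvariant floor (`Coinvariant.fibreTwo_le_card`, in gen 45ʼs packaging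
`OcticProduct.fibreTwo_mem_lowerBounds`) BY NAME; no `decide`, no certificate, no named fact, no `sorry`; `Interfaces.lean` (C1), every E term, B01,
`Transposition/*`, `PortJoin/*`, `D2Bridge/*` untouched.
HONEST FRAMING: `HC_CM` is NOT proved, here or anywhere in the tree; nothing here is a period, a count of record or a headline.
T5: n/a-class (hypothesis binders = the fields of `ShearedDihedral.Datum`; checker: self).
-/
import Summits.HodgeConjecture.CorCM.Census.ShearedDihedralDatum
import Summits.HodgeConjecture.CorCM.Census.OcticProductStabiliser

/-!
# The sheared dihedral family, II: `𝒦(G_n, c) = G_n`, `β = φ₂ + 2`, and the floor `μ(G_n, c) ≥ β(G_n, c) − 2`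

For a sheared dihedral datum `D` on `(G, c)` (`G ≅ G_n = ⟨g, s, x⟩`, `c = gⁿ`, part I):
* §1 **`𝒦(G, c) = G`** (`stabGen_eq_top`): `G` is generated by the INVOLUTIONS `x`, `gⁱx` and `s`, none of which has `c` among its powers
  (lit-andre-3ʼs `mem_stabGen_of_mul_self_eq_one`); hence `d₂(G/𝒦) = 0` (`indexTwoRank_stabGen_eq_zero`).
* §2 **`β(G, c) = φ₂(G, c) + 2`** (`card_block_eq_fibreTwo_add_two`; lit-andre-3ʼs closed form `φ₂ + 2 = β + d₂` for `|G|/2` even).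
* §3 **THE FLOOR**: every family `S` of faces whose base changes generate the Hodge span modulo pairs has **`β(G, c) ≤ |S| + 2`**
  (`card_block_le_card_add_two`, `card_block_sub_two_mem_lowerBounds`), i.e. `μ(G_n, gⁿ) ≥ β − 2`.  The conjectured SHEARED DIHEDRAL LAW is
  equality (numerically `μ = β − 2 = 20, 192, 2126` for `n = 2, 3, 4`; part I, module docstring).

## References
* [Pohlmann1968] H. Pohlmann, Algebraic cycles on abelian varieties of complex multiplication type, Ann. of Math. 88 (1968), Thm 1.
* [Milne1999] J. S. Milne, Lefschetz motives and the Tate conjecture, Compositio Math. 117 (1999), Prop. 2.1, p. 54.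
-/

namespace Summit.HodgeConjecture.CorCM.Census.ShearedDihedral

open Finset
open Summit.HodgeConjecture.CorCM.Prior.AllgGroup.RfwfAllgGroup
open Summit.HodgeConjecture.CorCM.Census.BlockParity
open Summit.HodgeConjecture.CorCM.Census.Coinvariant
open Summit.HodgeConjecture.CorCM.Census.TypeStabiliser
open Summit.HodgeConjecture.CorCM.Census.IndexTwo

noncomputable section

variable {G : Type*} [Group G] [Fintype G] [DecidableEq G] {c : G} {n : ℕ}
variable (D : Datum G c n)

namespace Datum

include D

/-! ## §1 `𝒦(G, c) = G` -/

omit [DecidableEq G] in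
/-- The involution `gⁱ x` lies in `𝒦`. [folklore] -/
theorem pow_mul_x_mem_stabGen (i : ℕ) : D.g ^ i * D.x ∈ stabGen c :=
  mem_stabGen_of_mul_self_eq_one c D.c_ne_one (D.pow_mul_x_mul_self i)

omit [DecidableEq G] in
/-- The involution `x` lies in `𝒦`. [folklore] -/
theorem x_mem_stabGen : D.x ∈ stabGen c :=
  mem_stabGen_of_mul_self_eq_one c D.c_ne_one D.hx2

omit [DecidableEq G] in
/-- The involution `s` lies in `𝒦`. [folklore] -/
theorem s_mem_stabGen : D.s ∈ stabGen c :=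
  mem_stabGen_of_mul_self_eq_one c D.c_ne_one D.hs2

omit [DecidableEq G] in
/-- Every rotation `gⁱ = (gⁱ x)·x` lies in `𝒦`. [folklore] -/
theorem pow_mem_stabGen (i : ℕ) : D.g ^ i ∈ stabGen c := by
  have h : D.g ^ i = D.g ^ i * D.x * D.x := by rw [mul_assoc, D.hx2, mul_one]
  rw [h]
  exact (stabGen c).mul_mem (D.pow_mul_x_mem_stabGen i) D.x_mem_stabGen

omit [DecidableEq G] in
/-- **`𝒦(G, c) = G`**: every element `gⁱ sʲ xᵉ` is a product of the involutions `gⁱx, x, s`. [folklore] -/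
private theorem mem_stabGen (y : G) : y ∈ stabGen c := by
  obtain ⟨i, -, j, -, e, -, rfl⟩ := D.exhaust y
  exact (stabGen c).mul_mem ((stabGen c).mul_mem (D.pow_mem_stabGen i) ((stabGen c).pow_mem D.s_mem_stabGen j))
    ((stabGen c).pow_mem D.x_mem_stabGen e)

omit [DecidableEq G] in
/-- **`𝒦(G, c) = ⊤`.** [folklore] -/
theorem stabGen_eq_top : stabGen c = ⊤ := top_unique fun y _ => D.mem_stabGen y

omit [DecidableEq G] in
/-- `d₂(G/𝒦) = 0`. [folklore] -/
private theorem indexTwoRank_stabGen_eq_zero : indexTwoRank (stabGen c) = 0 := by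
  rw [D.stabGen_eq_top]; exact indexTwoRank_top

/-! ## §2 `β = φ₂ + 2` -/

omit [DecidableEq G] in
/-- `|G|/2 = 4n` is even. [folklore] -/
private theorem even_card_div_two : Even (Fintype.card G / 2) :=
  ⟨2 * n, by rw [D.card_eq_eight_mul]; omega⟩

/-- **`β(G, c) = φ₂(G, c) + 2`** for every sheared dihedral datum. [folklore] -/
theorem card_block_eq_fibreTwo_add_two (hc2 : c * c = 1) : Fintype.card (Block c) = fibreTwo c hc2 + 2 := by
  have h := fibreTwo_add_two_eq_card_block_add_indexTwoRank c hc2 D.c_ne_one D.hcen D.even_card_div_two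
  rw [D.indexTwoRank_stabGen_eq_zero, add_zero] at h
  exact h.symm

/-- `φ₂(G, c) = β(G, c) − 2`. [folklore] -/
theorem fibreTwo_eq_card_block_sub_two (hc2 : c * c = 1) : fibreTwo c hc2 = Fintype.card (Block c) - 2 := by
  rw [D.card_block_eq_fibreTwo_add_two hc2, Nat.add_sub_cancel]

/-! ## §3 The floor `μ ≥ β − 2` -/

/-- **THE SHEARED DIHEDRAL FLOOR `μ(G, c) ≥ β(G, c) − 2`**: every family `S` of faces whose base changes generate the Hodge span modulo pairs
has `β(G, c) ≤ |S| + 2`. [folklore] -/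
theorem card_block_le_card_add_two (hc2 : c * c = 1) (S : Finset (CMF G c →₀ ℤ)) (hSF : (S : Set (CMF G c →₀ ℤ)) ⊆ gfaceSet G c hc2)
    (hgen : hodgeSpan c hc2 ≤ Submodule.span ℤ (pairSet c) ⊔ Submodule.span ℤ (translates c S)) :
    Fintype.card (Block c) ≤ S.card + 2 := by
  have hfloor := OcticProduct.fibreTwo_mem_lowerBounds hc2 D.hcen ⟨S, hSF, rfl, hgen⟩
  rw [D.card_block_eq_fibreTwo_add_two hc2]
  exact Nat.add_le_add_right hfloor 2

/-- **The floor for families of Hodge vectors** (not only faces; the form the field transfer consumes): every finite `S ⊆ hodgeSpan` whose base changes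
generate the Hodge span modulo pairs has `β(G, c) ≤ |S| + 2`. [folklore] -/
theorem card_block_le_card_add_two_of_subset_hodgeSpan (hc2 : c * c = 1) (S : Finset (CMF G c →₀ ℤ))
    (hSH : (S : Set (CMF G c →₀ ℤ)) ⊆ hodgeSpan c hc2)
    (hgen : hodgeSpan c hc2 ≤ Submodule.span ℤ (pairSet c) ⊔ Submodule.span ℤ (translates c S)) :
    Fintype.card (Block c) ≤ S.card + 2 := by
  have hfloor := fibreTwo_le_card c hc2 D.hcen S (Submodule.span ℤ (pairSet c)) le_rfl hSH
    (fun y hy => hgen (gfaceSet_subset_hodgeSpan c hc2 hy))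
  rw [D.card_block_eq_fibreTwo_add_two hc2]
  exact Nat.add_le_add_right hfloor 2

/-- The floor in `lowerBounds` form: `β(G, c) − 2` bounds below the size of every generating face family. [folklore] -/
theorem card_block_sub_two_mem_lowerBounds (hc2 : c * c = 1) :
    Fintype.card (Block c) - 2 ∈ lowerBounds {m : ℕ | ∃ S : Finset (CMF G c →₀ ℤ), ↑S ⊆ gfaceSet G c hc2 ∧ S.card = m ∧
      hodgeSpan c hc2 ≤ Submodule.span ℤ (pairSet c) ⊔ Submodule.span ℤ (translates c S)} := by
  rintro m ⟨S, hSF, rfl, hgen⟩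
  have h := D.card_block_le_card_add_two hc2 S hSF hgen
  omega

/-- The floor in `fibreTwo` currency (b09): `φ₂(G, c)` bounds below the size of every generating face family, and `φ₂ = β − 2`. [folklore] -/
theorem fibreTwo_mem_lowerBounds (hc2 : c * c = 1) :
    fibreTwo c hc2 ∈ lowerBounds {m : ℕ | ∃ S : Finset (CMF G c →₀ ℤ), ↑S ⊆ gfaceSet G c hc2 ∧ S.card = m ∧
      hodgeSpan c hc2 ≤ Submodule.span ℤ (pairSet c) ⊔ Submodule.span ℤ (translates c S)} ∧
    fibreTwo c hc2 + 2 = Fintype.card (Block c) :=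
  ⟨OcticProduct.fibreTwo_mem_lowerBounds hc2 D.hcen, (D.card_block_eq_fibreTwo_add_two hc2).symm⟩

/-- **The law reduces to the upper bound**: if SOME family of `β − 2` faces generates, then `μ(G, c) = β(G, c) − 2 = φ₂(G, c)`. [folklore] -/
theorem isLeast_of_exists (hc2 : c * c = 1)
    (hex : ∃ S : Finset (CMF G c →₀ ℤ), ↑S ⊆ gfaceSet G c hc2 ∧ S.card + 2 = Fintype.card (Block c) ∧
      hodgeSpan c hc2 ≤ Submodule.span ℤ (pairSet c) ⊔ Submodule.span ℤ (translates c S)) :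
    IsLeast {m : ℕ | ∃ S : Finset (CMF G c →₀ ℤ), ↑S ⊆ gfaceSet G c hc2 ∧ S.card = m ∧
      hodgeSpan c hc2 ≤ Submodule.span ℤ (pairSet c) ⊔ Submodule.span ℤ (translates c S)} (fibreTwo c hc2) := by
  obtain ⟨S, hSF, hcard, hgen⟩ := hex
  refine ⟨⟨S, hSF, ?_, hgen⟩, (D.fibreTwo_mem_lowerBounds hc2).1⟩
  have h := D.card_block_eq_fibreTwo_add_two hc2
  omega

end Datum

end

end Summit.HodgeConjecture.CorCM.Census.ShearedDihedral
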